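import Literature.NumberTheory.EllipticCurves.PastenHeightBoundsLemma68Proofs
import Literature.NumberTheory.EllipticCurves.IsogenyModularEquation
import Literature.NumberTheory.EllipticCurves.SingularModuliIntegral
import Literature.NumberTheory.EllipticCurves.RationalIsogenyDegreesProofs
import Literature.NumberTheory.EllipticCurves.IsogenySeparableFactorProofs
import Literature.NumberTheory.EllipticCurves.IsogenyXRationalFunctionProofs
import Literature.NumberTheory.DiophantineGeometry.MinimalDiscriminantNormProofs
import HarnessLib

/-!
# Pasten 2024, Lemma 6.8: the local input at a multiplicative prime, via the modular equation,
# and Lemma 6.8 from Mazur–Kenku alone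

`Proofs` file (theorems only — no definition, no named fact, no instance) of
`Literature/NumberTheory/EllipticCurves/PastenHeightBounds.lean` for its named fact
`Literature.NumberTheory.EllipticCurves.ModularForms.PastenShimura2024_lemma_6_8`
(H. Pasten, *Shimura curves and the abc conjecture*, J. Number Theory 254 (2024) =
arXiv:1705.09251, §6.4, Lemma 6.8, p. 22: for `ℚ`-isogenous elliptic curves `A, B` and a prime `p`
of multiplicative reduction, `c_p(A)/c_p(B)` has multiplicative height `≤ 163`, `c_p = ord_p Δ_min`).

`PastenHeightBoundsLemma68Proofs.lean` reduced the fact to Mazur–Kenku (the tree's named fact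
`mazurKenku_exists_cyclic_isogeny`) and a local input `hdvd` ("`c_p(A) ∣ deg φ · c_p(B)`", printed
via the functoriality of Néron component groups, absent from the tree).  This file **proves a local
input strong enough for Lemma 6.8** by a different, elementary route — the modular equation of prime
level — and so reduces the fact to Mazur–Kenku alone:

* `valuation_j_eq_exp_ordMinimalDiscriminant` — at a place `v` of multiplicative reduction,
  `|j(W)|_v = exp(c_v(W))`, i.e. `c_v(W) = ord_v Δ_min(W) = −ord_v j(W)` (Silverman, *AEC*,
  Prop. VII.5.1(b): `v(c₄) = 0` on a minimal model, `j = c₄³/Δ`).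
* `ordMinimalDiscriminant_eq_mul_or_of_degree_eq_prime` — **along a `ℚ`-isogeny of prime degree
  `ℓ` between curves with multiplicative reduction at `v`, `c_v(W) = ℓ c_v(W')` or
  `c_v(W') = ℓ c_v(W)`**: the `j`-invariants satisfy `Φ_ℓ(j, j') = 0 = Φ_ℓ(j', j)`
  (`Isogeny.evalXY_intModularPolynomial_j_of_degree_eq_prime`, `IsogenyModularEquation.lean`), and
  for a non-archimedean valuation `w` with `w(j), w(j') > 1` this forces `w(j) = w(j')^ℓ` or
  `w(j') = w(j)^ℓ` by the shape `Φ_ℓ = X^{ℓ+1} − X^ℓY^ℓ + (lower)` (Cox Thm. 11.18; the tree's link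
  lemma `valuation_eq_pow_of_evalXY_intModularPolynomial`, `SingularModuliIntegral.lean`) — in
  Tate-curve language, `q' = q^ℓ` or `q'^ℓ = ζq`.
* `exists_ordMinimalDiscriminant_mul_eq_mul_of_isCyclic` — for a **cyclic** `ℚ`-isogeny of degree
  `n`: `c_v(W) · b = c_v(W') · a` with `a · b ∣ n` (factor the isogeny through the quotient by the
  `ℓ`-torsion of its kernel, the tree's `Isogeny.exists_isCyclic_degree_eq_of_dvd` and
  `Isogeny.exists_eq_comp_of_ker_le`, *AEC* III.4.11–4.12, and induct; degree `1` preserves `j`).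
* **`PastenShimura2024_lemma_6_8_of_mazurKenku'`** — `mazurKenku_exists_cyclic_isogeny →
  PastenShimura2024_lemma_6_8`: Mazur–Kenku gives a cyclic `ℚ`-isogeny of degree `n ≤ 163`, so
  `a, b ≤ n ≤ 163`.  Hence `PastenShimura2024_lemma_6_8_holds` is
  `PastenShimura2024_lemma_6_8_of_mazurKenku' mazurKenku_exists_cyclic_isogeny_holds` once
  Mazur–Kenku (Mazur 1978, Thm. 1; Kenku 1982) is a theorem of the tree.
* **Conversely, the fact is Mazur-deep** (`prime_degree_le_163_of_PastenShimura2024_lemma_6_8`,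
  `not_exists_isogeny_degree_eq_of_prime_gt_163`): the statement of Lemma 6.8 by itself implies that
  an elliptic curve over `ℚ` with a prime of multiplicative reduction admits no `ℚ`-isogeny of prime
  degree `ℓ > 163` — the case "`j(E)` non-integral" of Mazur 1978, Thm. 1 (at an odd such prime
  already its Cor. 4.4, the Eisenstein quotient of `J₀(ℓ)`). By the prime-degree step, `c_v`, `c_v'`
  differ by the factor `ℓ`, while Lemma 6.8 makes `c_v/c_v'` a quotient of integers `≤ 163`. So no
  discharge of the fact can avoid (this case of) Mazur's theorem: the fact is recorded as a
  corollary of `mazurKenku_exists_cyclic_isogeny`, to be discharged by the one-line proof above when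
  that fact lands, and not as an independent target.

This replaces the printed argument (numerator and denominator of `c_p(A)/c_p(B)` divide the minimal
degree `n`, via `Φ_p` functorial) by the sharper classical statement that `c_p(A)/c_p(B) = a/b`
with `ab ∣ n` for a cyclic `n`-isogeny; the conclusion of Lemma 6.8 (height `≤ 163`) is the same.

## References

* [PastenShimura2024] H. Pasten, *Shimura curves and the abc conjecture*, J. Number Theory 254
  (2024) 214–335 = arXiv:1705.09251, §6.4 and Lemma 6.8 (p. 22). READ.
* [SilvermanAEC2009] J. H. Silverman, *The Arithmetic of Elliptic Curves*, 2nd ed., Prop. VII.5.1(b),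
  Cor. III.4.11, Prop. III.4.12, IX.6 Example 6.4.
* [Cox2013] D. A. Cox, *Primes of the form x² + ny²*, 2nd ed., §11.C Thm. 11.18.
* [Mazur1978] B. Mazur, *Rational isogenies of prime degree*, Invent. Math. 44 (1978), Thm. 1;
  [Kenku1982] M. A. Kenku, J. Number Theory 15 (1982) 199–202.
-/

noncomputable section

open scoped Classical

open WeierstrassCurve IsDedekindDomain

namespace Literature.NumberTheory.EllipticCurves.ModularForms

/-! ### `c_v(W) = −ord_v j(W)` at a multiplicative place -/

/-- **`|j(W)|_v = exp(ord_v Δ_min(W))` at a place of multiplicative reduction** (Silverman, *AEC*,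
Prop. VII.5.1(b): a minimal equation at `v` with multiplicative reduction has `v(c₄) = 0`,
`v(Δ) = ord_v Δ_min > 0`, and `j · Δ = c₄³`; so `ord_v j = −ord_v Δ_min`). Here `v.valuation ℚ` is
the `v`-adic valuation of `ℚ` (value `exp(−ord_v)`), computed in the completion `ℚ_v` on the local
minimal model `W.localMinimalModel v`. [cite: SilvermanAEC2009, Prop. VII.5.1(b)] -/
theorem valuation_j_eq_exp_ordMinimalDiscriminant (W : WeierstrassCurve ℚ) [W.IsElliptic]
    (v : HeightOneSpectrum ℤ) (hv : W.HasMultiplicativeReductionAt v) :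
    v.valuation ℚ W.j = WithZero.exp (W.ordMinimalDiscriminant v : ℤ) := by
  haveI := W.isElliptic_localMinimalModel v
  set Kv := v.adicCompletion ℚ
  set E := W.localMinimalModel v with hE
  have hm : E.HasMultiplicativeReduction (v.adicCompletionIntegers ℚ) := hv
  -- `j(E) = j(W)` in `ℚ_v`
  have hjE : E.j = algebraMap ℚ Kv W.j := by
    have hC : (((W.baseChange Kv).exists_isMinimal (v.adicCompletionIntegers ℚ)).choose •
        W.baseChange Kv).j = algebraMap ℚ Kv W.j := by
      rw [variableChange_j]; exact W.map_j _
    exact hC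
  -- `Δ(E)` comes from the integral model; its order is `ord_v Δ_min`
  set d : v.adicCompletionIntegers ℚ := (W.localMinimalIntegralModel v).Δ with hd
  have hdK : algebraMap _ Kv d = E.Δ := WeierstrassCurve.integralModel_Δ_eq _ _
  have hd0 : d ≠ 0 := by
    intro h0
    have := (WeierstrassCurve.isUnit_Δ (W := E)).ne_zero
    rw [← hdK, h0, map_zero] at this
    exact this rfl
  obtain ⟨n, hn, hvn⟩ := HeightOneSpectrum.exists_addVal_adicCompletionIntegers_eq ℚ v d hd0
  have hord : W.ordMinimalDiscriminant v = n := by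
    rw [WeierstrassCurve.ordMinimalDiscriminant, ← hd, hn]
    rfl
  -- `c₄(E)` is a unit: `Valued.v c₄ = 1`
  have hequiv := WeierstrassCurve.isEquiv_valuation_maximalIdeal_of_le_one_iff
    (WeierstrassCurve.valued_le_one_iff_mem_range_adicCompletionIntegers v (K := ℚ))
  have hc₄ : (Valued.v : Valuation Kv (WithZero (Multiplicative ℤ))) E.c₄ = 1 :=
    (Valuation.isEquiv_iff_val_eq_one.mp hequiv).mp hm.multiplicativeReduction
  -- `j · Δ = c₄³`
  have key : algebraMap ℚ Kv W.j * E.Δ = E.c₄ ^ 3 := by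
    rw [← hjE, WeierstrassCurve.j, ← WeierstrassCurve.coe_Δ', mul_comm, ← mul_assoc,
      Units.mul_inv, one_mul]
  have hval := congrArg (Valued.v : Valuation Kv (WithZero (Multiplicative ℤ))) key
  rw [map_mul, map_pow, hc₄, one_pow, ← hdK] at hval
  change Valued.v (algebraMap ℚ Kv W.j) * Valued.v (d : Kv) = 1 at hval
  rw [hvn, WeierstrassCurve.valued_algebraMap_adicCompletion] at hval
  rw [eq_inv_of_mul_eq_one_left hval, hord, WithZero.exp_neg, inv_inv]

/-- `|j(W)|_v > 1` at a multiplicative place (`c_v ≥ 1`, Silverman *AEC* VII.5.1(b)).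
[cite: SilvermanAEC2009, Prop. VII.5.1(b)] -/
theorem one_lt_valuation_j_of_hasMultiplicativeReductionAt (W : WeierstrassCurve ℚ) [W.IsElliptic]
    (v : HeightOneSpectrum ℤ) (hv : W.HasMultiplicativeReductionAt v) : 1 < v.valuation ℚ W.j := by
  rw [valuation_j_eq_exp_ordMinimalDiscriminant W v hv, ← WithZero.exp_zero, WithZero.exp_lt_exp]
  have h := WeierstrassCurve.ordMinimalDiscriminant_ne_zero_of_hasMultiplicativeReductionAt v W hv
  omega

/-! ### The prime-degree step: `c_v(W) = ℓ c_v(W')` or `c_v(W') = ℓ c_v(W)` -/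

/-- **Along a `ℚ`-isogeny of prime degree `ℓ`, `ord_v Δ_min` is multiplied or divided by `ℓ` at a
multiplicative place.** For elliptic curves `W, W'` over `ℚ`, an isogeny `φ : W → W'` over `ℚ` of
prime degree `ℓ` and a place `v` at which both have multiplicative reduction:
`c_v(W) = ℓ · c_v(W')` or `c_v(W') = ℓ · c_v(W)`.  Proof: `Φ_ℓ(j, j') = 0 = Φ_ℓ(j', j)`
(`Isogeny.evalXY_intModularPolynomial_j_of_degree_eq_prime`); with `w = |·|_v`, `w(j), w(j') > 1`,
the link lemma `valuation_eq_pow_of_evalXY_intModularPolynomial` (the two leading monomials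
`X^{ℓ+1}`, `−X^ℓY^ℓ` of `Φ_ℓ`, Cox Thm. 11.18 (iii)–(iv)) gives `w(j) = w(j')^ℓ` if `w(j') ≤ w(j)`
and `w(j') = w(j)^ℓ` otherwise; and `w(j) = exp(c_v)` (`valuation_j_eq_exp_ordMinimalDiscriminant`).
Classically: on Tate curves an `ℓ`-isogeny is `q ↦ q^ℓ` or `q ↦ ζq^{1/ℓ}` (Silverman *ATAEC* V.3–5).
[cite: Cox2013, §11.C Thm. 11.18(iii)–(iv)] [cite: SilvermanAEC2009, Prop. VII.5.1(b)] -/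
theorem ordMinimalDiscriminant_eq_mul_or_of_degree_eq_prime {W W' : WeierstrassCurve ℚ}
    [W.IsElliptic] [W'.IsElliptic] (φ : Isogeny W W') {ℓ : ℕ} (hℓ : ℓ.Prime)
    (hdeg : φ.degree = ℓ) (v : HeightOneSpectrum ℤ) (hv : W.HasMultiplicativeReductionAt v)
    (hv' : W'.HasMultiplicativeReductionAt v) :
    W.ordMinimalDiscriminant v = ℓ * W'.ordMinimalDiscriminant v ∨
      W'.ordMinimalDiscriminant v = ℓ * W.ordMinimalDiscriminant v := by
  haveI : Fact ℓ.Prime := ⟨hℓ⟩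
  obtain ⟨h1, h2⟩ := φ.evalXY_intModularPolynomial_j_of_degree_eq_prime hdeg
  set w := v.valuation ℚ with hw
  have hwZ : ∀ n : ℤ, w (n : ℚ) ≤ 1 := fun n ↦ by
    rw [hw, show ((n : ℤ) : ℚ) = algebraMap ℤ ℚ n from (eq_intCast (algebraMap ℤ ℚ) n).symm]
    exact HeightOneSpectrum.valuation_le_one v n
  have hx := one_lt_valuation_j_of_hasMultiplicativeReductionAt W v hv
  have hy := one_lt_valuation_j_of_hasMultiplicativeReductionAt W' v hv'
  have hjx := valuation_j_eq_exp_ordMinimalDiscriminant W v hv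
  have hjy := valuation_j_eq_exp_ordMinimalDiscriminant W' v hv'
  rcases le_total (w W'.j) (w W.j) with hle | hle
  · left
    have h := valuation_eq_pow_of_evalXY_intModularPolynomial ℓ w hwZ h1 hx hle
    rw [hw] at h
    rw [hjx, hjy, ← WithZero.exp_nsmul, WithZero.exp_inj, nsmul_eq_mul] at h
    exact_mod_cast h
  · right
    have h := valuation_eq_pow_of_evalXY_intModularPolynomial ℓ w hwZ h2 hy hle
    rw [hw] at h
    rw [hjx, hjy, ← WithZero.exp_nsmul, WithZero.exp_inj, nsmul_eq_mul] at h
    exact_mod_cast h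

/-! ### Cyclic isogenies: `c_v(W) · b = c_v(W') · a` with `ab ∣ deg` -/

/-- **Factoring a cyclic isogeny through a cyclic quotient of given degree.** A cyclic isogeny
`φ : W → W'` over `ℚ` of degree `n` with `ℓ ∣ n` factors as `φ = λ ∘ ψ` with `ψ : W → W''` cyclic
of degree `ℓ` onto an elliptic curve `W''` over `ℚ` (the quotient by `ker φ ∩ E[ℓ]`, Silverman
*AEC* Prop. III.4.12 / Rem. III.4.13.2 — the tree's `Isogeny.exists_isCyclic_degree_eq_of_dvd`) and
`λ : W'' → W'` cyclic of degree `n/ℓ` (Cor. III.4.11 — the tree's `Isogeny.exists_eq_comp_of_ker_le`;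
`ker λ = ψ(ker φ)` is cyclic and `#ker φ = #ker λ · #ker ψ`). [cite: SilvermanAEC2009, Cor. III.4.11 and Prop. III.4.12] -/
theorem exists_isCyclic_factor_of_dvd {W W' : WeierstrassCurve ℚ} [W.IsElliptic]
    [W'.IsElliptic] (φ : Isogeny W W') (hφ : φ.IsCyclic) {ℓ : ℕ} (hdvd : ℓ ∣ φ.degree) :
    ∃ (W'' : WeierstrassCurve ℚ) (_ : W''.IsElliptic) (ψ : Isogeny W W'') (lam : Isogeny W'' W'),
      ψ.IsCyclic ∧ ψ.degree = ℓ ∧ lam.IsCyclic ∧ lam.degree * ℓ = φ.degree := by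
  obtain ⟨W'', hW'', ψ, hψcyc, hψdeg, hψker⟩ := φ.exists_isCyclic_degree_eq_of_dvd hφ hdvd
  haveI := hW''
  have hker : ∀ P : W.geomPoints, ψ P = 0 → φ P = 0 := by
    intro P hP
    have hP' : P ∈ ψ.toAddMonoidHom.ker := hP
    rw [hψker] at hP'
    exact (AddSubgroup.mem_inf.mp hP').1
  have hdegle : ψ.deg ≤ Nat.card ψ.toAddMonoidHom.ker := by
    rw [← Isogeny.degree_eq_deg]; exact le_rfl
  obtain ⟨lam, hlam⟩ := ψ.exists_eq_comp_of_ker_le φ hdegle hker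
  have hcomp : φ.toAddMonoidHom = lam.toAddMonoidHom.comp ψ.toAddMonoidHom := by
    ext P; exact hlam P
  -- degrees
  have hcard : φ.degree = lam.degree * ψ.degree := by
    unfold Isogeny.degree
    rw [hcomp]
    exact AddMonoidHom.natCard_ker_comp_of_surjective _ _ ψ.surjective
  -- `ker λ = ψ(ker φ)` is cyclic
  have hkerlam : lam.toAddMonoidHom.ker = φ.toAddMonoidHom.ker.map ψ.toAddMonoidHom := by
    ext Q
    simp only [AddMonoidHom.mem_ker, AddSubgroup.mem_map]
    constructor
    · intro hQ
      obtain ⟨P, rfl⟩ := ψ.surjective Q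
      exact ⟨P, by rw [Isogeny.coe_toAddMonoidHom, hlam P]; exact hQ, rfl⟩
    · rintro ⟨P, hP, rfl⟩
      rw [Isogeny.coe_toAddMonoidHom, hlam P] at hP
      exact hP
  have hlamcyc : lam.IsCyclic := by
    haveI : IsAddCyclic φ.toAddMonoidHom.ker := hφ
    change IsAddCyclic lam.toAddMonoidHom.ker
    rw [hkerlam]
    exact isAddCyclic_of_surjective _ (AddMonoidHom.addSubgroupMap_surjective ψ.toAddMonoidHom _)
  refine ⟨W'', hW'', ψ, lam, hψcyc, hψdeg, hlamcyc, ?_⟩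
  rw [hcard, hψdeg]

/-- **The local input for a cyclic isogeny.** For elliptic curves `W, W'` over `ℚ`, a cyclic
isogeny `φ : W → W'` over `ℚ` of degree `n` and a place `v` at which both have multiplicative
reduction, there are positive integers `a, b` with `a · b ∣ n` and `c_v(W) · b = c_v(W') · a`
(`c_v = ord_v Δ_min`; classically `c_v(W)/c_v(W') = a/b` where the cyclic kernel meets the toric
part of the Néron `n`-gon in a group of order `b` — Pasten §6.4 p. 22 for the weaker "numerator and
denominator divide `n`").  Proof by strong induction on `n`: degree `1` preserves `j`, hence `c_v`
(`Isogeny.j_eq_of_degree_eq_one`, `valuation_j_eq_exp_ordMinimalDiscriminant`); otherwise factor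
through a prime-degree cyclic quotient (`exists_isCyclic_factor_of_dvd`), apply
`ordMinimalDiscriminant_eq_mul_or_of_degree_eq_prime` to the first factor (the intermediate curve is
`ℚ`-isogenous to `W`, hence multiplicative at `v`, `hasMultiplicativeReductionAt_of_isIsogenous`)
and the induction hypothesis to the second. [cite: PastenShimura2024, §6.4 and Lemma 6.8 (p. 22)] -/
theorem exists_ordMinimalDiscriminant_mul_eq_mul_of_isCyclic (n : ℕ) :
    ∀ {W W' : WeierstrassCurve ℚ} [W.IsElliptic] [W'.IsElliptic] (φ : Isogeny W W'),
      φ.IsCyclic → φ.degree = n → ∀ v : HeightOneSpectrum ℤ, W.HasMultiplicativeReductionAt v →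
        W'.HasMultiplicativeReductionAt v →
          ∃ a b : ℕ, 0 < a ∧ 0 < b ∧ a * b ∣ n ∧
            W.ordMinimalDiscriminant v * b = W'.ordMinimalDiscriminant v * a := by
  induction n using Nat.strong_induction_on with
  | _ n ih =>
    intro W W' _ _ φ hφ hdeg v hv hv'
    by_cases h1 : n = 1
    · -- degree `1`: same `j`, same `c_v`
      subst h1
      refine ⟨1, 1, one_pos, one_pos, by norm_num, ?_⟩
      have hj := φ.j_eq_of_degree_eq_one hdeg
      have h := valuation_j_eq_exp_ordMinimalDiscriminant W v hv
      rw [hj, valuation_j_eq_exp_ordMinimalDiscriminant W' v hv', WithZero.exp_inj] at h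
      rw [mul_one, mul_one]
      exact_mod_cast h.symm
    · have hn0 : n ≠ 0 := by rw [← hdeg]; exact φ.degree_pos.ne'
      have hn1 : 1 < n := by omega
      -- a prime factor `ℓ` of `n` and the factorisation `φ = λ ∘ ψ`
      set ℓ := n.minFac with hℓdef
      have hℓ : ℓ.Prime := Nat.minFac_prime h1
      have hℓn : ℓ ∣ n := Nat.minFac_dvd n
      obtain ⟨W'', hW'', ψ, lam, hψcyc, hψdeg, hlamcyc, hlamdeg⟩ :=
        exists_isCyclic_factor_of_dvd φ hφ (hdeg ▸ hℓn)
      haveI := hW''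
      rw [hdeg] at hlamdeg
      have hv'' : W''.HasMultiplicativeReductionAt v := hasMultiplicativeReductionAt_of_isIsogenous ⟨ψ⟩ v hv
      -- the prime step for `ψ` and the induction hypothesis for `λ`
      have hstep := ordMinimalDiscriminant_eq_mul_or_of_degree_eq_prime ψ hℓ hψdeg v hv hv''
      have hlt : lam.degree < n := by
        have h2 := hℓ.two_le
        have hpos := lam.degree_pos
        nlinarith
      obtain ⟨a, b, ha, hb, hab, heq⟩ := ih lam.degree hlt lam hlamcyc rfl v hv'' hv'
      rcases hstep with hs | hs
      · -- `c = ℓ c''`: `c · b = ℓ c'' b = ℓ a c'`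
        refine ⟨ℓ * a, b, Nat.mul_pos hℓ.pos ha, hb, ?_, ?_⟩
        · rw [← hlamdeg, show ℓ * a * b = a * b * ℓ by ring]
          exact Nat.mul_dvd_mul_right hab ℓ
        · rw [hs, mul_assoc, heq]; ring
      · -- `c'' = ℓ c`: `c · (ℓ b) = c'' b = c' a`
        refine ⟨a, ℓ * b, ha, Nat.mul_pos hℓ.pos hb, ?_, ?_⟩
        · rw [← hlamdeg, show a * (ℓ * b) = a * b * ℓ by ring]
          exact Nat.mul_dvd_mul_right hab ℓ
        · rw [← heq, hs]; ring

/-! ### Lemma 6.8 from Mazur–Kenku -/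

/-- **Pasten 2024, Lemma 6.8, from Mazur–Kenku alone.** Assume the tree's named fact
`mazurKenku_exists_cyclic_isogeny` (Mazur 1978, Thm. 1; Kenku 1982; Silverman *AEC* IX.6 Ex. 6.4:
two `ℚ`-isogenous elliptic curves over `ℚ` are joined by a cyclic `ℚ`-isogeny of degree in Kenku's
list, `≤ 163`). Then for `ℚ`-isogenous elliptic `W, W'` and a place `v` of multiplicative reduction
of `W` (hence of `W'`, `hasMultiplicativeReductionAt_of_isIsogenous`) there are `1 ≤ m, n ≤ 163`
with `c_v(W) · n = c_v(W') · m`: by `exists_ordMinimalDiscriminant_mul_eq_mul_of_isCyclic` for the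
Mazur–Kenku isogeny, `c_v(W) · b = c_v(W') · a` with `ab ∣ deg ≤ 163`.  So the discharge
`PastenShimura2024_lemma_6_8_holds` is this theorem applied to `mazurKenku_exists_cyclic_isogeny_holds`
once Mazur–Kenku is proved in the tree. [cite: PastenShimura2024, Lemma 6.8 and its proof (p. 22)] -/
theorem PastenShimura2024_lemma_6_8_of_mazurKenku' (hMK : mazurKenku_exists_cyclic_isogeny) :
    PastenShimura2024_lemma_6_8 := by
  intro W W' _ _ hiso v hv
  have hv' : W'.HasMultiplicativeReductionAt v := hasMultiplicativeReductionAt_of_isIsogenous hiso v hv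
  obtain ⟨φ, hcyc, hφ⟩ := hMK W W' hiso
  have hn := le_of_mem_kenkuDegrees hφ
  obtain ⟨a, b, ha, hb, hab, h⟩ :=
    exists_ordMinimalDiscriminant_mul_eq_mul_of_isCyclic φ.degree φ hcyc rfl v hv hv'
  have habn : a * b ≤ φ.degree := Nat.le_of_dvd φ.degree_pos hab
  refine ⟨a, b, ha, ?_, hb, ?_, h⟩
  · have : a ≤ a * b := Nat.le_mul_of_pos_right a hb
    omega
  · have : b ≤ a * b := Nat.le_mul_of_pos_left b ha
    omega

/-! ### Conversely: Lemma 6.8 bounds prime isogeny degrees at a multiplicative prime -/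

/-- **The statement of Lemma 6.8 implies Mazur's bound for prime isogeny degrees of curves with a
multiplicative prime.** Assume `PastenShimura2024_lemma_6_8`. If `W/ℚ` is an elliptic curve with
multiplicative reduction at the place `v` and `φ : W → W'` is a `ℚ`-isogeny of prime degree `ℓ`
onto an elliptic curve `W'`, then `ℓ ≤ 163`. Proof: `W'` is multiplicative at `v`
(`hasMultiplicativeReductionAt_of_isIsogenous`); by the prime-degree step
(`ordMinimalDiscriminant_eq_mul_or_of_degree_eq_prime`) `c_v(W) = ℓ c_v(W')` or
`c_v(W') = ℓ c_v(W)`; Lemma 6.8 gives `c_v(W) · n = c_v(W') · m` with `1 ≤ m, n ≤ 163`; cancelling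
the positive `c_v` (*AEC* VII.5.1(b)) leaves `ℓ n = m` or `n = ℓ m`, so `ℓ ≤ 163`. This is the case
"`j(E) ∉ ℤ_p`" of Mazur 1978, Thm. 1 (for odd `p` already its Cor. 4.4, via the Eisenstein
quotient of `J₀(ℓ)`), which is why the fact is not discharged independently of
`mazurKenku_exists_cyclic_isogeny`.
[cite: PastenShimura2024, Lemma 6.8 (p. 22)] [cite: Mazur1978, Thm. 1 and Cor. 4.4] -/
theorem prime_degree_le_163_of_PastenShimura2024_lemma_6_8 (h68 : PastenShimura2024_lemma_6_8)
    {W W' : WeierstrassCurve ℚ} [W.IsElliptic] [W'.IsElliptic] (φ : Isogeny W W') {ℓ : ℕ}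
    (hℓ : ℓ.Prime) (hdeg : φ.degree = ℓ) (v : HeightOneSpectrum ℤ)
    (hv : W.HasMultiplicativeReductionAt v) : ℓ ≤ 163 := by
  have hv' : W'.HasMultiplicativeReductionAt v :=
    hasMultiplicativeReductionAt_of_isIsogenous ⟨φ⟩ v hv
  obtain ⟨m, n, hm, hm163, hn, hn163, hmn⟩ := h68 W W' ⟨φ⟩ v hv
  have hc := Nat.pos_of_ne_zero
    (WeierstrassCurve.ordMinimalDiscriminant_ne_zero_of_hasMultiplicativeReductionAt v W hv)
  have hc' := Nat.pos_of_ne_zero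
    (WeierstrassCurve.ordMinimalDiscriminant_ne_zero_of_hasMultiplicativeReductionAt v W' hv')
  rcases ordMinimalDiscriminant_eq_mul_or_of_degree_eq_prime φ hℓ hdeg v hv hv' with h | h
  · -- `c = ℓ c'`: `ℓ c' n = c' m`, so `ℓ n = m ≤ 163`
    rw [h] at hmn
    have h1 : ℓ * n = m := by
      have : W'.ordMinimalDiscriminant v * (ℓ * n) = W'.ordMinimalDiscriminant v * m := by
        rw [← hmn]; ring
      exact Nat.eq_of_mul_eq_mul_left hc' this
    nlinarith
  · -- `c' = ℓ c`: `c n = ℓ c m`, so `n = ℓ m ≥ ℓ`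
    rw [h] at hmn
    have h1 : n = ℓ * m := by
      have : W.ordMinimalDiscriminant v * n = W.ordMinimalDiscriminant v * (ℓ * m) := by
        rw [hmn]; ring
      exact Nat.eq_of_mul_eq_mul_left hc this
    nlinarith

/-- **No `ℚ`-isogeny of prime degree `ℓ > 163` out of an elliptic curve over `ℚ` with a prime of
multiplicative reduction, granted Lemma 6.8** — the contrapositive form of
`prime_degree_le_163_of_PastenShimura2024_lemma_6_8` (Mazur 1978, Thm. 1, case of non-integral
`j`-invariant, as a consequence of the fact). [cite: PastenShimura2024, Lemma 6.8 (p. 22)]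
[cite: Mazur1978, Thm. 1] -/
theorem not_exists_isogeny_degree_eq_of_prime_gt_163 (h68 : PastenShimura2024_lemma_6_8)
    {W W' : WeierstrassCurve ℚ} [W.IsElliptic] [W'.IsElliptic] (v : HeightOneSpectrum ℤ)
    (hv : W.HasMultiplicativeReductionAt v) {ℓ : ℕ} (hℓ : ℓ.Prime) (h163 : 163 < ℓ) :
    ¬ ∃ φ : Isogeny W W', φ.degree = ℓ := by
  rintro ⟨φ, hdeg⟩
  exact absurd (prime_degree_le_163_of_PastenShimura2024_lemma_6_8 h68 φ hℓ hdeg v hv)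
    (not_le.2 h163)

end Literature.NumberTheory.EllipticCurves.ModularForms

end
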